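import Summits.Ventures.YMGap.RobustBall.OneStateMaster
import Summits.Ventures.YMGap.RobustBall.OneStateBoundaryRows
import Summits.Ventures.YMGap.RobustBall.WilsonOneStateSymmetry
import Summits.Ventures.YMGap.RobustBall.PerturbedAxisCovariance
import Summits.Ventures.YMGap.Conjectures.TwistCensusParityReductions
import Summits.Ventures.YMGap.Census.TwistCensusGermLaw
import HarnessLib

/-!
# Venture statement — YMGap (cell `pub-ymgap`) — CONJUNCT BODIES T40 (track Y2: ONE STATE — every boundary condition, lattice symmetries), T41 (track (b): census structure) (seat p3-g6)

STATUS: BOOKED by the lead's R253 / R254 (2026-08-23T11:53Z / 12:01Z): V20 := T40 (six parts, seat ds-3 countersigned the bytes, rb-theory the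
composition) + T41 with clauses (i), (ii) AND (iii) (seat engine-1 countersigned (ii)/(iii) on the exact bytes, lit-2 (i)); referee pre-audit F-388. A second
block file of v1.10, `StatementConjunctsV20B.lean` (T42 ff., R253 (b), owner-countersigned texts only), is filed separately (400-line cap); the index entry
`YMGapStatementV1_10 := YMGapStatementV1_9 ∧ T40_… ∧ T41_… ∧ …` is appended to `StatementIndex.lean` (PLAN R215) after the block files land. T40/T41 are
the next free numbers after `StatementConjunctsV19.lean` (T29, T37, T38, T39); nothing is renumbered.

HONEST FRAMING. WHAT THIS IS: bodies `Tk_… : Prop` + witnesses `Tk_…_holds` of TWO conjuncts of the venture statement (index of record: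
`Summits/Ventures/YMGap/Statement.lean` frozen at v1.6, continued in `StatementIndex.lean`), kernel-checked with NO hypothesis, closing by TREE
constants only. Lattice statements; every window / ball radius is where a BOUND is certified to close, not a physical transition.
* **T40** (track Y2 + Wilson action, seat ds-3 g11 texts `HOME/ds/ds3/lean/g11/V1XConjunctsDS3g11.lean`, six bodies consolidated VERBATIM as the
  parts `T40a`–`T40f`; `T40_OneStateBoundaryAndSymmetry := T40a ∧ … ∧ T40f`): ONE STATE — EVERY BOUNDARY CONDITION + LATTICE SYMMETRIES.
  (a) every `d`, `N`, `β`, tier 1: under `PerturbedMassGapAt d N β W supp` (continuous terms reading their own links, locally finite support)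
  there is ONE DLR state `μ` and, along EVERY sequence of finite link volumes eventually containing every finite set, the finite-volume
  perturbed Gibbs distributions with EVERY sequence of boundary fields converge to `μ` on every bounded continuous observable, uniformly in the
  boundary field (Georgii 4.17 / 7.11 for the perturbed specifications; `RobustBall.boundaryLimit_of_perturbedMassGapAt`); (b) the same for the
  Wilson action under `MassGapAt d N β` (`RobustBall.boundaryLimit_of_massGapAt`); (c) tier 1: under `PerturbedMassGapAt` and translation
  COVARIANCE of the finite-volume Hamiltonians the one DLR state is translation invariant (`RobustBall.oneState_translationInvariant_of_perturbedMassGapAt`);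
  (d) Wilson: under `MassGapAt d N β` the one DLR state is translation invariant (`RobustBall.oneState_translationInvariant_of_massGapAt`);
  (e) Wilson, `d ≥ 1`: under `MassGapAt d N β` the one DLR state is the ONLY infinite-volume limit point of the periodic torus Wilson states, is
  translation invariant and invariant under every permutation of the axes (`RobustBall.oneState_symmetric_of_massGapAt`); (f) tier 1: under
  `PerturbedMassGapAt` and AXIS-PERMUTATION covariance of the Hamiltonians the one DLR state is invariant under every axis permutation
  (`RobustBall.oneState_permInvariant_of_perturbedMassGapAt`). The named cells (`SU(2)` `|b| ≤ 9/50`, every `N` at 't Hooft `< 1/(8d)`, the mixed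
  action, the pair witnesses, the trail shapes) live in the cited files and in T9 / T37 / T38; T40 is the GENERAL statement they instantiate.
  WHAT T40 IS NOT: no new window, no rate, nothing about reflection positivity, rotations of the continuum, or a continuum limit.
* **T41** (track (b), census structure; seat lit-2 g12 text `HOME/lit/lit2-lean/T-texts-lit2g12b.lean` = part (i) verbatim, seat engine-1's
  `Conjectures/TwistCensusParityReductions.lean` = part (ii) by name): WHAT IS PROVED of the typed census conjecture C-1
  `Conjectures.TwistCensusParity` (EMPIRICAL LAW, Sunday item (16); it STAYS OPEN and asserts nothing) AND EXACTLY WHAT REMAINS. (i) THE GERM LAW (G)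
  HOLDS on EVERY 3-torus `L₀ × L₁ × L₂` (all `L_k ≥ 1`), every plane `i < j`, third axis `ρ`: the one-character `SU(2)` census polynomial
  `N_{ij} = (Z⁻_{ij})′Z − Z⁻_{ij}Z′` has `coeff_k N_{ij} = 0` for `k + 1 < LᵢLⱼ` and `coeff_{LᵢLⱼ−1} N_{ij} = −2·LᵢLⱼ·L_ρ` (`Census.germLaw_fin_three`:
  the size-`LᵢLⱼ` plaquette sets meeting the stack oddly with non-zero Haar moment are exactly the `L_ρ` flat sheets — Tomboulis's minimal
  polymers, arXiv:0707.2179 §6.2); (ii) the typed conjecture is EQUIVALENT to two Haar-moment statements per plane — for every 3-torus with sides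
  `≥ 2` and every plane: `sheetMomentSum = L_ρ` and `0 < cosheetMomentSum · I(Λ₂)` (`Conjectures.twistCensusParity_iff_moments`; the degree bound
  (D).≤ and (P) ⇐ (G) ∧ (S∞) are theorems); (iii) with (G) proved, the typed conjecture is EQUIVALENT to ONE SIGN CONDITION per plane on two explicit
  `SU(2)` Haar moments: for every 3-torus with sides `≥ 2` and every plane, `0 < I(Λ₂ ∖ Π₀) · I(Λ₂)` (`Π₀` the flat `(i, j)`-sheet at `x_ρ = 0`;
  `Conjectures.twistCensusParity_iff_product`, engine-1's revision 2) — «what is proved of C-1 and exactly what remains; the conjecture stays OPEN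
  (EMPIRICAL LAW)». Finite tori; NOTHING asserted about the degree law (D), the leading-sign law (S∞) or the parity law (P) themselves, root
  locations, (5.15)/(5.16), limits or confinement.
-/

noncomputable section

namespace Summit.Ventures.YMGap

section T40sec

open MeasureTheory Filter Topology
open Literature.Probability.LatticeModels hiding configShift configShift_apply
open Literature.MathematicalPhysics.QuantumLattice (fundamentalRep ZdEdge LGConfig ymSpecification ymGibbsMeasures
  IsZdTranslationInvariant edgeShift configShift infiniteVolumeLimitPoints)
open Literature.MathematicalPhysics.QuantumFieldTheory (edgePermZd configPermZd)
open Summit.Ventures.YMGap.RobustBall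

/-- **T40 (a) — every `d`, `N`, `β` (tier 1): EVERY BOUNDARY CONDITION.** Under `PerturbedMassGapAt d N β W supp` (continuous terms reading
their own links, locally finite support) there is ONE probability measure `μ` with `perturbedGibbsMeasures = {μ}`, and for EVERY sequence of
finite link volumes `Λₙ` eventually containing every finite set: for EVERY sequence of boundary fields `ηₙ` and every bounded continuous
observable `F`, `∫ F dγ^W_{Λₙ}(· | ηₙ) → ∫ F dμ` (full sequence), and uniformly in the boundary field
(`RobustBall.boundaryLimit_of_perturbedMassGapAt`; seat ds-3's `T_OneStateBoundary` verbatim). -/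
def T40a_OneStateBoundary : Prop :=
  ∀ (d N : ℕ) (β : ℝ) (W : Potential (ZdEdge d) (Matrix.specialUnitaryGroup (Fin N) ℂ))
    (supp : Finset (ZdEdge d) → Finset (Finset (ZdEdge d))),
    PerturbedMassGapAt d N β W supp → (∀ X, Continuous (W X)) → (∀ X, DependsOn (W X) (↑X : Set (ZdEdge d))) →
    W.IsSupportedBy supp →
    ∃ μ : Measure (LGConfig d (Matrix.specialUnitaryGroup (Fin N) ℂ)),
      perturbedGibbsMeasures (d := d) (fundamentalRep (Fin N)) ((N : ℝ) * β) W supp = {μ} ∧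
      ∀ Λs : ℕ → Finset (ZdEdge d), (∀ Δ : Finset (ZdEdge d), ∀ᶠ n in atTop, Δ ⊆ Λs n) →
        (∀ (ηs : ℕ → LGConfig d (Matrix.specialUnitaryGroup (Fin N) ℂ))
          (F : LGConfig d (Matrix.specialUnitaryGroup (Fin N) ℂ) → ℝ), Continuous F → (∃ C, ∀ U, |F U| ≤ C) →
          Tendsto (fun n => ∫ U, F U ∂(perturbedYM (fundamentalRep (Fin N)) ((N : ℝ) * β) W supp (Λs n) (ηs n)))
            atTop (𝓝 (∫ U, F U ∂μ))) ∧
        ∀ (F : LGConfig d (Matrix.specialUnitaryGroup (Fin N) ℂ) → ℝ), Continuous F → (∃ C, ∀ U, |F U| ≤ C) →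
          ∀ ε : ℝ, 0 < ε → ∀ᶠ n in atTop, ∀ η : LGConfig d (Matrix.specialUnitaryGroup (Fin N) ℂ),
            |∫ U, F U ∂(perturbedYM (fundamentalRep (Fin N)) ((N : ℝ) * β) W supp (Λs n) η) - ∫ U, F U ∂μ| < ε

/-- T40 (a) holds. -/
theorem T40a_OneStateBoundary_holds : T40a_OneStateBoundary :=
  fun _ _ _ _ _ hgap hWc hdep hsupp => boundaryLimit_of_perturbedMassGapAt hgap hWc hdep hsupp

/-- **T40 (b) — every `d`, `N`, `β` (Wilson action, `W = 0`): EVERY BOUNDARY CONDITION.** Under `MassGapAt d N β` the unique DLR state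
of `SU(N)` lattice Yang–Mills at tree coupling `N β` is the limit of the finite-volume Wilson–Gibbs distributions with EVERY boundary field along
every cofinal sequence of volumes, on every bounded continuous observable, uniformly in the boundary field
(`RobustBall.boundaryLimit_of_massGapAt`; cells `su2_wilson_boundaryLimit_of_abs_le` at every `|b| ≤ 9/50`, `suN_wilson_boundaryLimit_sharp` at
every 't Hooft `|β| < 1/(8d)`; seat ds-3's `T_WilsonBoundary` verbatim). -/
def T40b_WilsonBoundary : Prop :=
  ∀ (d N : ℕ) (β : ℝ), MassGapAt d N β →
    ∃ μ : Measure (LGConfig d (Matrix.specialUnitaryGroup (Fin N) ℂ)),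
      ymGibbsMeasures (d := d) (fundamentalRep (Fin N)) ((N : ℝ) * β) = {μ} ∧
      ∀ Λs : ℕ → Finset (ZdEdge d), (∀ Δ : Finset (ZdEdge d), ∀ᶠ n in atTop, Δ ⊆ Λs n) →
        (∀ (ηs : ℕ → LGConfig d (Matrix.specialUnitaryGroup (Fin N) ℂ))
          (F : LGConfig d (Matrix.specialUnitaryGroup (Fin N) ℂ) → ℝ), Continuous F → (∃ C, ∀ U, |F U| ≤ C) →
          Tendsto (fun n => ∫ U, F U ∂(ymSpecification (fundamentalRep (Fin N)) ((N : ℝ) * β) (Λs n) (ηs n)))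
            atTop (𝓝 (∫ U, F U ∂μ))) ∧
        ∀ (F : LGConfig d (Matrix.specialUnitaryGroup (Fin N) ℂ) → ℝ), Continuous F → (∃ C, ∀ U, |F U| ≤ C) →
          ∀ ε : ℝ, 0 < ε → ∀ᶠ n in atTop, ∀ η : LGConfig d (Matrix.specialUnitaryGroup (Fin N) ℂ),
            |∫ U, F U ∂(ymSpecification (fundamentalRep (Fin N)) ((N : ℝ) * β) (Λs n) η) - ∫ U, F U ∂μ| < ε

/-- T40 (b) holds. -/
theorem T40b_WilsonBoundary_holds : T40b_WilsonBoundary := fun _ _ _ hgap => boundaryLimit_of_massGapAt hgap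

/-- **T40 (c) — every `d`, `N`, `β` (tier 1): TRANSLATION INVARIANCE.** Under `PerturbedMassGapAt d N β W supp` (continuous terms reading
their own links, locally finite support) and TRANSLATION COVARIANCE of the finite-volume Hamiltonians `H^W_{Λ+v}(θ_v U) = H^W_Λ(U)`, the one
DLR state is translation invariant: `perturbedGibbsMeasures = {μ}` with `μ ∘ θ_v⁻¹ = μ` for all `v ∈ ℤ^d`
(`RobustBall.oneState_translationInvariant_of_perturbedMassGapAt`; tier-2 twin `oneState_translationInvariant_of_perturbedMassGapAtS`; named
members: the `SU(2)` mixed action, the isotropic / axial pair witnesses, the translated trail shapes; seat ds-3's `T_OneStateTranslationInvariant`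
verbatim). -/
def T40c_OneStateTranslationInvariant : Prop :=
  ∀ (d N : ℕ) (β : ℝ) (W : Potential (ZdEdge d) (Matrix.specialUnitaryGroup (Fin N) ℂ))
    (supp : Finset (ZdEdge d) → Finset (Finset (ZdEdge d))),
    PerturbedMassGapAt d N β W supp → (∀ X, Continuous (W X)) → (∀ X, DependsOn (W X) (↑X : Set (ZdEdge d))) →
    W.IsSupportedBy supp →
    (∀ (Λ : Finset (ZdEdge d)) (v : Site d) (U : LGConfig d (Matrix.specialUnitaryGroup (Fin N) ℂ)),
      hamiltonianIn W supp (Λ.map (edgeShift v).toEmbedding) (configShift v U) = hamiltonianIn W supp Λ U) →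
    ∃ μ : Measure (LGConfig d (Matrix.specialUnitaryGroup (Fin N) ℂ)),
      perturbedGibbsMeasures (d := d) (fundamentalRep (Fin N)) ((N : ℝ) * β) W supp = {μ} ∧ IsZdTranslationInvariant μ

/-- T40 (c) holds. -/
theorem T40c_OneStateTranslationInvariant_holds : T40c_OneStateTranslationInvariant :=
  fun _ _ _ _ _ hgap hWc hdep hsupp hH => oneState_translationInvariant_of_perturbedMassGapAt hgap hWc hdep hsupp hH

/-- **T40 (d) — every `d`, `N`, `β` (Wilson action): TRANSLATION INVARIANCE.** Under `MassGapAt d N β` the unique DLR state of `SU(N)`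
lattice Yang–Mills at tree coupling `N β` is translation invariant (`RobustBall.oneState_translationInvariant_of_massGapAt`; cells
`su2_wilson_oneState_translationInvariant` at every `|b| ≤ 9/50`, `suN_wilson_oneState_translationInvariant_sharp`; seat ds-3's
`T_WilsonTranslationInvariant` verbatim). -/
def T40d_WilsonTranslationInvariant : Prop :=
  ∀ (d N : ℕ) (β : ℝ), MassGapAt d N β →
    ∃ μ : Measure (LGConfig d (Matrix.specialUnitaryGroup (Fin N) ℂ)),
      ymGibbsMeasures (d := d) (fundamentalRep (Fin N)) ((N : ℝ) * β) = {μ} ∧ IsZdTranslationInvariant μ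

/-- T40 (d) holds. -/
theorem T40d_WilsonTranslationInvariant_holds : T40d_WilsonTranslationInvariant :=
  fun _ _ _ hgap => oneState_translationInvariant_of_massGapAt hgap

/-- **T40 (e) — every `d ≥ 1`, `N`, `β` (Wilson action): ONE STATE = THE ONLY TORUS LIMIT POINT, TRANSLATION AND AXIS-PERMUTATION
INVARIANT.** Under `MassGapAt d N β` the unique DLR state of `SU(N)` lattice Yang–Mills at tree coupling `N β` is the only infinite-volume limit
point of the periodic torus Wilson states, is translation invariant and is invariant under every permutation of the coordinate axes
(`RobustBall.oneState_symmetric_of_massGapAt`; seat ds-3's `T_WilsonOneStateSymmetric` verbatim). -/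
def T40e_WilsonOneStateSymmetric : Prop :=
  ∀ (d N : ℕ) [NeZero d] (β : ℝ), MassGapAt d N β →
    ∃ μ : Measure (LGConfig d (Matrix.specialUnitaryGroup (Fin N) ℂ)),
      ymGibbsMeasures (d := d) (fundamentalRep (Fin N)) ((N : ℝ) * β) = {μ} ∧
      infiniteVolumeLimitPoints (d := d) (fundamentalRep (Fin N)) ((N : ℝ) * β) = {μ} ∧
      IsZdTranslationInvariant μ ∧ ∀ π : Equiv.Perm (Fin d), μ.map (configPermZd π) = μ

/-- T40 (e) holds. -/
theorem T40e_WilsonOneStateSymmetric_holds : T40e_WilsonOneStateSymmetric :=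
  fun _ _ _ _ hgap => oneState_symmetric_of_massGapAt hgap

/-- **T40 (f) — every `d`, `N`, `β` (tier 1): AXIS-PERMUTATION INVARIANCE.** Under `PerturbedMassGapAt d N β W supp` (continuous terms
reading their own links, locally finite support) and AXIS-PERMUTATION COVARIANCE of the finite-volume Hamiltonians
`H^W_{πΛ}(configPermZd π U) = H^W_Λ(U)`, the one DLR state is invariant under every permutation of the axes
(`RobustBall.oneState_permInvariant_of_perturbedMassGapAt`; named member: the `SU(2)` mixed action `su2_mixedAction_oneState_permInvariant`;
seat ds-3's `T_OneStatePermInvariant` verbatim). -/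
def T40f_OneStatePermInvariant : Prop :=
  ∀ (d N : ℕ) (β : ℝ) (W : Potential (ZdEdge d) (Matrix.specialUnitaryGroup (Fin N) ℂ))
    (supp : Finset (ZdEdge d) → Finset (Finset (ZdEdge d))),
    PerturbedMassGapAt d N β W supp → (∀ X, Continuous (W X)) → (∀ X, DependsOn (W X) (↑X : Set (ZdEdge d))) →
    W.IsSupportedBy supp →
    (∀ (Λ : Finset (ZdEdge d)) (π : Equiv.Perm (Fin d)) (U : LGConfig d (Matrix.specialUnitaryGroup (Fin N) ℂ)),
      hamiltonianIn W supp (Λ.map (edgePermZd π).toEmbedding) (configPermZd π U) = hamiltonianIn W supp Λ U) →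
    ∃ μ : Measure (LGConfig d (Matrix.specialUnitaryGroup (Fin N) ℂ)),
      perturbedGibbsMeasures (d := d) (fundamentalRep (Fin N)) ((N : ℝ) * β) W supp = {μ} ∧
        ∀ π : Equiv.Perm (Fin d), μ.map (configPermZd π) = μ

/-- T40 (f) holds. -/
theorem T40f_OneStatePermInvariant_holds : T40f_OneStatePermInvariant :=
  fun _ _ _ _ _ hgap hWc hdep hsupp hH => oneState_permInvariant_of_perturbedMassGapAt hgap hWc hdep hsupp hH

/-- **T40 — track Y2 / Wilson action: ONE STATE — EVERY BOUNDARY CONDITION AND THE LATTICE SYMMETRIES, HYPOTHESIS-FREE** (seat ds-3 g11;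
parts (a)–(f) above): under the cell's one-state hypotheses (`PerturbedMassGapAt` for members of the tier-1 ball with the displayed regularity /
covariance binders; `MassGapAt` for the Wilson action) the ONE DLR state is reached from EVERY boundary condition along every cofinal sequence of
volumes, uniformly in the boundary field, and it is translation invariant and (Wilson: always; members: under axis-permutation covariance)
invariant under the permutations of the coordinate axes; for the Wilson action it is moreover the only torus limit point. Lattice statements; no
window beyond the cited cells, no rate, nothing continuum. -/
def T40_OneStateBoundaryAndSymmetry : Prop :=
  T40a_OneStateBoundary ∧ T40b_WilsonBoundary ∧ T40c_OneStateTranslationInvariant ∧ T40d_WilsonTranslationInvariant ∧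
    T40e_WilsonOneStateSymmetric ∧ T40f_OneStatePermInvariant

/-- T40 holds (the six parts). -/
theorem T40_OneStateBoundaryAndSymmetry_holds : T40_OneStateBoundaryAndSymmetry :=
  ⟨T40a_OneStateBoundary_holds, T40b_WilsonBoundary_holds, T40c_OneStateTranslationInvariant_holds,
    T40d_WilsonTranslationInvariant_holds, T40e_WilsonOneStateSymmetric_holds, T40f_OneStatePermInvariant_holds⟩

end T40sec

section T41sec

open Polynomial
open Literature.MathematicalPhysics.QuantumLattice
open Literature.MathematicalPhysics.QuantumFieldTheory
open Literature.MathematicalPhysics.QuantumFieldTheory.Tomboulis2007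
open Summit.Ventures.YMGap.Census

/-- **T41 — track (b), census structure: THE GERM LAW (G) ON EVERY 3-TORUS, AND WHAT EXACTLY REMAINS OF THE TYPED CENSUS CONJECTURE C-1,
KERNEL-CHECKED.** (i) For every `L₀ × L₁ × L₂` (all `L_k ≥ 1`), every plane `i < j` and third axis `ρ ∉ {i, j}`, the census polynomial `N_{ij}` of
the twist stack `𝒱_{ij}` satisfies `coeff_k N_{ij} = 0` (`k + 1 < LᵢLⱼ`) and `coeff_{LᵢLⱼ − 1} N_{ij} = −2·LᵢLⱼ·L_ρ` — the body of
`Conjectures.TwistCensusParity.GermLaw` (`Census.germLaw_fin_three`; seat lit-2's text verbatim). (ii) The typed conjecture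
`Conjectures.TwistCensusParity` ((P) on `(0, ∞)` ∧ (G) ∧ (D) ∧ (S∞) on every 3-torus with sides `≥ 2`) is EQUIVALENT to: for every such torus
and every plane, `sheetMomentSum = L_ρ` and `0 < cosheetMomentSum · I(Λ₂)` (`Conjectures.twistCensusParity_iff_moments`, seat engine-1). By (i)
the first moment statement HOLDS; (iii) hence the typed conjecture is EQUIVALENT to one sign condition per plane on two explicit `SU(2)` Haar moments:
for every such torus and every plane `i < j`, `0 < I(Λ₂ ∖ Π₀) · I(Λ₂)`, `Π₀ = Census.flatSheet Ls hij 0` (`Conjectures.twistCensusParity_iff_product`,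
seat engine-1, revision 2). «What is proved of C-1 and exactly what remains; the conjecture stays OPEN (EMPIRICAL LAW)» — it is NOT asserted, proved or
refuted here and keeps its status (item (16)). Finite tori, one-character model; nothing about root locations, (5.15)/(5.16), limits or confinement. -/
def T41_TwistCensusGermLaw : Prop :=
  (∀ (Ls : Fin 3 → ℕ) [∀ k, NeZero (Ls k)] (i j ρ : Fin 3) (hij : i < j), ρ ≠ i → ρ ≠ j →
      (∀ k : ℕ, k + 1 < Ls i * Ls j → (Census.twistCensusPoly Ls (Census.rectVortexSheet Ls i j hij)).coeff k = 0) ∧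
        (Census.twistCensusPoly Ls (Census.rectVortexSheet Ls i j hij)).coeff (Ls i * Ls j - 1) =
          -(2 * ((Ls i * Ls j : ℕ) : ℝ) * (Ls ρ : ℝ))) ∧
    (Conjectures.TwistCensusParity ↔ ∀ (Ls : Fin 3 → ℕ) [∀ i, NeZero (Ls i)], (∀ k, 2 ≤ Ls k) →
      ∀ (i j ρ : Fin 3) (hij : i < j), ρ ≠ i → ρ ≠ j →
        sheetMomentSum Ls hij = Ls ρ ∧ 0 < cosheetMomentSum Ls hij * rectCharMoment Ls Finset.univ) ∧
    (Conjectures.TwistCensusParity ↔ ∀ (Ls : Fin 3 → ℕ) [∀ i, NeZero (Ls i)], (∀ k, 2 ≤ Ls k) →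
      ∀ (i j : Fin 3) (hij : i < j),
        0 < Census.rectCharMoment Ls (Finset.univ \ Census.flatSheet Ls hij 0) * Census.rectCharMoment Ls Finset.univ)

/-- T41 holds (`Census.germLaw_fin_three`, `Conjectures.twistCensusParity_iff_moments`, `Conjectures.twistCensusParity_iff_product`). -/
theorem T41_TwistCensusGermLaw_holds : T41_TwistCensusGermLaw :=
  ⟨fun Ls _ i j ρ hij hρi hρj => Census.germLaw_fin_three Ls i j ρ hij hρi hρj, Conjectures.twistCensusParity_iff_moments,
    Conjectures.twistCensusParity_iff_product⟩

end T41sec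

end Summit.Ventures.YMGap

end
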